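import Summits.CriticalPhenomena.Ising3DConformalLimit.Theorems.SynchronousCouplingRotationJoiningIsotropyDefs
import HarnessLib

/-!
# Route `SynchronousCoupling`, crux `RotationJoining` (stmt-CriticalPhenomena-18763), line `SketchIdeator2` (reshape 2) —
# the rotation `T⁻¹ = Aᵀ/3` as a linear isometry of `ℝ³`, and Kozma's `ψ⁻¹` is within `2/n` of it at scale `n`

Lead's tools for `stub_isotropyTransfer` (far-field comparison): the commensurate rotation `T = A/3` (`AᵀA = 9·I`) gives a
linear isometry `R = T⁻¹` of `EuclideanSpace ℝ (Fin 3)` with explicit coordinates, and the tilted-geometry stub's clauses (2), (3)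
(`ψ ∘ ψ⁻¹ = id`, `|3ψ(x) − Ax|_∞ ≤ 2`) give `|3ψ⁻¹(w) − Aᵀw|_∞ ≤ 3` on `ℤ³`, hence `‖ψ⁻¹(w)/n − R(w/n)‖ ≤ 2/n`.
References: G. Kozma, Acta Math. 199 (2007) §6.1. No definitions (the isometry is produced existentially), no sorry.
-/

noncomputable section

namespace Summit.CriticalPhenomena.Ising3DConformalLimit.Cruxes.RotationJoining.RateSplitting

open Literature.Probability.LatticeModels

/-- Row `0` of `A3`: `(A x)₀ = 2x₀ + 2x₁ − x₂`. [folklore] -/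
theorem A3_mulVec_zero (x : Fin 3 → ℤ) : A3.mulVec x 0 = 2 * x 0 + 2 * x 1 - x 2 := by
  simp [A3, Matrix.mulVec, dotProduct, Fin.sum_univ_three]; ring

/-- Row `1` of `A3`: `(A x)₁ = −x₀ + 2x₁ + 2x₂`. [folklore] -/
theorem A3_mulVec_one (x : Fin 3 → ℤ) : A3.mulVec x 1 = -x 0 + 2 * x 1 + 2 * x 2 := by
  simp [A3, Matrix.mulVec, dotProduct, Fin.sum_univ_three]

/-- Row `2` of `A3`: `(A x)₂ = 2x₀ − x₁ + 2x₂`. [folklore] -/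
theorem A3_mulVec_two (x : Fin 3 → ℤ) : A3.mulVec x 2 = 2 * x 0 - x 1 + 2 * x 2 := by
  simp [A3, Matrix.mulVec, dotProduct, Fin.sum_univ_three]; ring

/-- **Kozma's `ψ⁻¹` is the rotation `T⁻¹ = Aᵀ/3` up to a bounded error**: from `ψ (ψ⁻¹ w) = w` and `|3ψ(x) − Ax|_∞ ≤ 2`
(clauses (2), (3) of `TiltGeometry`) and `AᵀA = 9I`: `|3 ψ⁻¹(w)ᵢ − (Aᵀ w)ᵢ| ≤ 3` for every `w ∈ ℤ³` (the three rows of `Aᵀ` are the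
columns `(2,−1,2)`, `(2,2,−1)`, `(−1,2,2)` of `A`). [folklore] -/
theorem psiInv_sub_transpose_le (hTG : TiltGeometry) (w : Site 3) :
    |3 * psiInv w 0 - (2 * w 0 - w 1 + 2 * w 2)| ≤ 3 ∧
    |3 * psiInv w 1 - (2 * w 0 + 2 * w 1 - w 2)| ≤ 3 ∧
    |3 * psiInv w 2 - (-w 0 + 2 * w 1 + 2 * w 2)| ≤ 3 := by
  obtain ⟨-, h2, h3, -⟩ := hTG
  have e0 := h3 (psiInv w) 0
  have e1 := h3 (psiInv w) 1
  have e2 := h3 (psiInv w) 2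
  rw [h2 w] at e0 e1 e2
  rw [A3_mulVec_zero] at e0
  rw [A3_mulVec_one] at e1
  rw [A3_mulVec_two] at e2
  rw [abs_le] at e0 e1 e2
  refine ⟨?_, ?_, ?_⟩ <;> rw [abs_le] <;> constructor <;> omega

/-- **The rotation `T⁻¹ = Aᵀ/3` of `ℝ³` as a linear isometry**, with its coordinates:
`R(v) = ((2v₀ − v₁ + 2v₂)/3, (2v₀ + 2v₁ − v₂)/3, (−v₀ + 2v₁ + 2v₂)/3)` (`RᵀR = I` because `AAᵀ = 9I`). [folklore] -/
theorem exists_rotation_transpose :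
    ∃ R : EuclideanSpace ℝ (Fin 3) ≃ₗᵢ[ℝ] EuclideanSpace ℝ (Fin 3), ∀ v : EuclideanSpace ℝ (Fin 3),
      R v 0 = (2 * v 0 - v 1 + 2 * v 2) / 3 ∧ R v 1 = (2 * v 0 + 2 * v 1 - v 2) / 3 ∧
        R v 2 = (-v 0 + 2 * v 1 + 2 * v 2) / 3 := by
  -- the forward and backward maps in coordinates
  let f : EuclideanSpace ℝ (Fin 3) → EuclideanSpace ℝ (Fin 3) := fun v =>
    WithLp.toLp 2 ![(2 * v 0 - v 1 + 2 * v 2) / 3, (2 * v 0 + 2 * v 1 - v 2) / 3, (-v 0 + 2 * v 1 + 2 * v 2) / 3]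
  let g : EuclideanSpace ℝ (Fin 3) → EuclideanSpace ℝ (Fin 3) := fun v =>
    WithLp.toLp 2 ![(2 * v 0 + 2 * v 1 - v 2) / 3, (-v 0 + 2 * v 1 + 2 * v 2) / 3, (2 * v 0 - v 1 + 2 * v 2) / 3]
  have hf0 : ∀ v, f v 0 = (2 * v 0 - v 1 + 2 * v 2) / 3 := fun v => rfl
  have hf1 : ∀ v, f v 1 = (2 * v 0 + 2 * v 1 - v 2) / 3 := fun v => rfl
  have hf2 : ∀ v, f v 2 = (-v 0 + 2 * v 1 + 2 * v 2) / 3 := fun v => rfl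
  have hg0 : ∀ v, g v 0 = (2 * v 0 + 2 * v 1 - v 2) / 3 := fun v => rfl
  have hg1 : ∀ v, g v 1 = (-v 0 + 2 * v 1 + 2 * v 2) / 3 := fun v => rfl
  have hg2 : ∀ v, g v 2 = (2 * v 0 - v 1 + 2 * v 2) / 3 := fun v => rfl
  have hext : ∀ a b : EuclideanSpace ℝ (Fin 3), a 0 = b 0 → a 1 = b 1 → a 2 = b 2 → a = b := by
    intro a b h0 h1 h2
    ext i
    fin_cases i
    · exact h0
    · exact h1
    · exact h2
  let e : EuclideanSpace ℝ (Fin 3) ≃ₗ[ℝ] EuclideanSpace ℝ (Fin 3) :=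
    { toFun := f
      invFun := g
      map_add' := fun a b => by
        refine hext _ _ ?_ ?_ ?_
        · rw [hf0, PiLp.add_apply, PiLp.add_apply, PiLp.add_apply, PiLp.add_apply, hf0, hf0]; ring
        · rw [hf1, PiLp.add_apply, PiLp.add_apply, PiLp.add_apply, PiLp.add_apply, hf1, hf1]; ring
        · rw [hf2, PiLp.add_apply, PiLp.add_apply, PiLp.add_apply, PiLp.add_apply, hf2, hf2]; ring
      map_smul' := fun c a => by
        refine hext _ _ ?_ ?_ ?_
        · rw [hf0, RingHom.id_apply, PiLp.smul_apply, PiLp.smul_apply, PiLp.smul_apply, PiLp.smul_apply, hf0,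
            smul_eq_mul, smul_eq_mul, smul_eq_mul, smul_eq_mul]; ring
        · rw [hf1, RingHom.id_apply, PiLp.smul_apply, PiLp.smul_apply, PiLp.smul_apply, PiLp.smul_apply, hf1,
            smul_eq_mul, smul_eq_mul, smul_eq_mul, smul_eq_mul]; ring
        · rw [hf2, RingHom.id_apply, PiLp.smul_apply, PiLp.smul_apply, PiLp.smul_apply, PiLp.smul_apply, hf2,
            smul_eq_mul, smul_eq_mul, smul_eq_mul, smul_eq_mul]; ring
      left_inv := fun a => by
        refine hext _ _ ?_ ?_ ?_
        · rw [hg0, hf0, hf1, hf2]; ring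
        · rw [hg1, hf0, hf1, hf2]; ring
        · rw [hg2, hf0, hf1, hf2]; ring
      right_inv := fun a => by
        refine hext _ _ ?_ ?_ ?_
        · rw [hf0, hg0, hg1, hg2]; ring
        · rw [hf1, hg0, hg1, hg2]; ring
        · rw [hf2, hg0, hg1, hg2]; ring }
  have he : ∀ v, e v = f v := fun v => rfl
  have hnorm : ∀ v : EuclideanSpace ℝ (Fin 3), ‖e v‖ = ‖v‖ := by
    intro v
    rw [EuclideanSpace.norm_eq, EuclideanSpace.norm_eq]
    congr 1
    simp only [Fin.sum_univ_three, Real.norm_eq_abs, sq_abs, he, hf0, hf1, hf2]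
    ring
  refine ⟨⟨e, hnorm⟩, fun v => ?_⟩
  exact ⟨hf0 v, hf1 v, hf2 v⟩

/-- **At scale `n`, `ψ⁻¹` is within `2/n` of the rotation `R = T⁻¹`**: for `w ∈ ℤ³` and `n ≥ 1`, with the points
`p = ψ⁻¹(w)/n` and `q = w/n` of `ℝ³`, `‖p − R q‖ ≤ 2/n` (coordinatewise `|ψ⁻¹(w)ᵢ − (Aᵀw)ᵢ/3| ≤ 1`, Euclidean norm `≤ √3/n`).
[folklore] -/
theorem norm_psiInv_sub_rotation_le (hTG : TiltGeometry)
    {R : EuclideanSpace ℝ (Fin 3) ≃ₗᵢ[ℝ] EuclideanSpace ℝ (Fin 3)}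
    (hR : ∀ v : EuclideanSpace ℝ (Fin 3), R v 0 = (2 * v 0 - v 1 + 2 * v 2) / 3 ∧
      R v 1 = (2 * v 0 + 2 * v 1 - v 2) / 3 ∧ R v 2 = (-v 0 + 2 * v 1 + 2 * v 2) / 3)
    {n : ℕ} (hn : 1 ≤ n) (w : Site 3) :
    ‖(WithLp.toLp 2 fun i => ((psiInv w i : ℤ) : ℝ) / n : EuclideanSpace ℝ (Fin 3)) -
        R (WithLp.toLp 2 fun i => ((w i : ℤ) : ℝ) / n)‖ ≤ 2 / n := by
  obtain ⟨e0, e1, e2⟩ := psiInv_sub_transpose_le hTG w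
  obtain ⟨r0, r1, r2⟩ := hR (WithLp.toLp 2 fun i => ((w i : ℤ) : ℝ) / n)
  have hn' : (0:ℝ) < n := by exact_mod_cast hn
  -- coordinate bounds `|dᵢ| ≤ 1/n`
  have key : ∀ (p a : ℤ), |3 * p - a| ≤ 3 → |(p : ℝ) / n - (a : ℝ) / n / 3| ≤ 1 / n := by
    intro p a h
    have h' : |(3 * p - a : ℤ)| ≤ 3 := h
    have h'' : |(3 * (p:ℝ) - a)| ≤ 3 := by exact_mod_cast h'
    rw [show (p : ℝ) / n - (a : ℝ) / n / 3 = (3 * (p:ℝ) - a) / (3 * n) by field_simp, abs_div,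
      abs_of_pos (by positivity : (0:ℝ) < 3 * n), div_le_div_iff₀ (by positivity) hn']
    nlinarith
  have d0 : |((psiInv w 0 : ℤ) : ℝ) / n -
      (2 * (((w 0 : ℤ) : ℝ) / n) - ((w 1 : ℤ) : ℝ) / n + 2 * (((w 2 : ℤ) : ℝ) / n)) / 3| ≤ 1 / n := by
    have := key (psiInv w 0) (2 * w 0 - w 1 + 2 * w 2) e0
    push_cast at this
    convert this using 2; ring
  have d1 : |((psiInv w 1 : ℤ) : ℝ) / n -
      (2 * (((w 0 : ℤ) : ℝ) / n) + 2 * (((w 1 : ℤ) : ℝ) / n) - ((w 2 : ℤ) : ℝ) / n) / 3| ≤ 1 / n := by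
    have := key (psiInv w 1) (2 * w 0 + 2 * w 1 - w 2) e1
    push_cast at this
    convert this using 2; ring
  have d2 : |((psiInv w 2 : ℤ) : ℝ) / n -
      (-(((w 0 : ℤ) : ℝ) / n) + 2 * (((w 1 : ℤ) : ℝ) / n) + 2 * (((w 2 : ℤ) : ℝ) / n)) / 3| ≤ 1 / n := by
    have := key (psiInv w 2) (-w 0 + 2 * w 1 + 2 * w 2) e2
    push_cast at this
    convert this using 2; ring
  have hb : ∀ {t : ℝ}, |t| ≤ 1 / n → t ^ 2 ≤ (1 / n) ^ 2 := fun h => by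
    rw [← sq_abs]; exact pow_le_pow_left₀ (abs_nonneg _) h 2
  have s0 := hb d0
  have s1 := hb d1
  have s2 := hb d2
  rw [EuclideanSpace.norm_eq]
  simp only [Fin.sum_univ_three, PiLp.sub_apply, Real.norm_eq_abs, sq_abs, r0, r1, r2]
  calc Real.sqrt _ ≤ Real.sqrt ((2 / n) ^ 2) := by
        apply Real.sqrt_le_sqrt
        have h4 : (2 / n : ℝ) ^ 2 = 4 * (1 / n) ^ 2 := by ring
        rw [h4]
        nlinarith [sq_nonneg ((1:ℝ) / n)]
    _ = 2 / n := Real.sqrt_sq (by positivity)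

end Summit.CriticalPhenomena.Ising3DConformalLimit.Cruxes.RotationJoining.RateSplitting

end
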